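import Literature.NumberTheory.GaloisRepresentations.SerreGL2LiftingLevelPSquared
import Mathlib.LinearAlgebra.Matrix.NonsingularInverse
import Mathlib.Data.ZMod.Basic
import HarnessLib

/-!
# The kernel lattice of a subgroup of `GL₂(ℤ/9ℤ)` mapping onto `GL₂(𝔽₃)`

Route `UniversalToricDescent` (BirchSwinnertonDyer, W-ALL row 2·3@3), `--supports` crux
stmt-BirchSwinnertonDyer-20695 `TwinSplitIMCAtThreeGoodSS` (and its `a₃ = 0` re-key 23594): the
`3`-ADIC-IMAGE delta of the `p = 3` port of the Heegner-point Kolyvagin-system divisibility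
(Howard 2004 Thm. B / Castella–Wan 2024 Thm. 5.12 carry «`Gal(K̄/K) → Aut_{ℤ_p}(T)` onto», which at
`p ≥ 5` follows from the crux's mod-`p` hypothesis by Serre and at `p = 3` does NOT — seat memo
SUPSET-AT3-v8 §1(d)). Namespace `Summit.BirchSwinnertonDyer.BirchSwinnertonDyer.Theorems.LevelNine`;
theorems only (no definition, no named fact); route-free group theory, a companion of `Literature.NumberTheory.GaloisRepresentations.SerreGL2LiftingLevelPSquared` (Serre's
lemma from level `p²`) for the one prime where Serre's lemma from level `p` FAILS, `p = 3`
(J.-P. Serre, *Abelian `ℓ`-adic representations and elliptic curves* (1968), Ch. IV §3.4, Lemma 3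
and Exercises; N. D. Elkies, arXiv:math/0612734, §0–§1: a subgroup `G' < GL₂(ℤ/9ℤ)` of index `27`
mapping onto `GL₂(𝔽₃)` with full determinant, whose intersection with the level-`3` kernel is the
group of scalars `{1, 4, 7}`). This file is the bookkeeping half of the LEVEL-`9` SATURATION
THEOREM (`UniversalToricDescentLevelNineSaturation`: onto `GL₂(𝔽₃)` + full determinant + ONE non-scalar element
`≡ 1 (mod 3)` ⟹ everything).

For a subgroup `H ≤ GL₂(ℤ/9ℤ)` the elements of `H` in the level-`3` kernel are `1 + 3C`; modulo `9`
the class of `1 + 3C` only depends on `C mod 3`, products add the `C`'s and inverses negate them,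
so `{C mod 3 : 1 + 3C ∈ H}` is an `𝔽₃`-subspace of `M₂(𝔽₃)`; if `H` maps onto `GL₂(𝔽₃)` it is
stable under conjugation by ALL of `GL₂(ℤ/9ℤ)` (conjugate by a lift in `H`). We record this with
the membership predicate written out (`∃ h ∈ H, ↑h = 1 + 3 • C`) rather than a new definition:

* `exists_eq_add_three_smul_of_map_eq`, `three_smul_eq_of_map_eq`, `exists_coe_eq_one_add_three_smul`,
  `det_one_add_three_smul` — arithmetic of `2 × 2` matrices over `ℤ/9ℤ` modulo `3`;
* `kernel_add_mem`, `kernel_neg_mem`, `kernel_sub_mem`, `kernel_nsmul_mem`, `kernel_congr` — the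
  lattice operations; `kernel_conj_mem` — conjugation-stability under `H ↠ GL₂(𝔽₃)`;
* `exists_upper_unipotent_nine`, `exists_lower_unipotent_nine`, `exists_diag_neg_one_nine`,
  `exists_swap_nine` — the four elements of `GL₂(ℤ/9ℤ)` used to move kernel classes around, and the
  two exact conjugation identities `upper_conj_sub`, `diag_conj_sub`.

Design: `ZMod 9` and `ZMod 3` literally (every concrete identity is `decide`d), reduction written as
`Matrix.GeneralLinearGroup.map (ZMod.castHom three_dvd_nine (ZMod 3))` as in the siblings; no
notation, no instance, no definition. Not here: the saturation argument itself and the application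
to elliptic curves (`UniversalToricDescentThreeAdicImageOfNonscalarKernel`). BSD is not proved by any of this.

## References

* [SerreAbelianLadic1968] J.-P. Serre, *Abelian `ℓ`-adic representations and elliptic curves*
  (1968), Ch. IV §3.4, Lemma 3 and Exercises.
* [Elkies2006ThreeAdic] N. D. Elkies, *Elliptic curves with 3-adic Galois representation surjective
  mod 3 but not mod 9*, arXiv:math/0612734 (2006), §0–§1 (held: `paper:arxiv-math_0612734`, p0001–p0002).
-/

open scoped MatrixGroups

set_option linter.dupNamespace false
set_option autoImplicit false

namespace Summit.BirchSwinnertonDyer.BirchSwinnertonDyer.Theorems.LevelNine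

open Matrix

/-! ### Arithmetic in `ℤ/9ℤ` and reduction of `2 × 2` matrices modulo `3` -/

section LevelNineArithmetic

/-- `3 ∣ 9`. [folklore] -/
theorem three_dvd_nine : 3 ∣ 9 := by norm_num

/-- `9 = 0` in `ℤ/9ℤ`. [folklore] -/
theorem nine_eq_zero_zmod : (9 : ZMod 9) = 0 := by decide

/-- `3 · 3 = 0` in `ℤ/9ℤ`. [folklore] -/
theorem three_mul_three_zmod : (3 : ZMod 9) * 3 = 0 := by decide

/-- A multiple of `3` in `ℤ/9ℤ` is `0`, `3` or `6`. [folklore] -/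
theorem three_mul_eq_three_or_six (m : ZMod 9) (hm : 3 * m ≠ 0) : 3 * m = 3 ∨ 3 * m = 6 := by
  revert m; decide

/-- The kernel of `ℤ/9ℤ → ℤ/3ℤ` is `3·(ℤ/9ℤ)`. [folklore] -/
theorem exists_eq_three_mul_of_castHom_eq_zero (a : ZMod 9)
    (h : ZMod.castHom three_dvd_nine (ZMod 3) a = 0) : ∃ b : ZMod 9, a = 3 * b := by
  rw [ZMod.castHom_apply, ZMod.cast_eq_val, ZMod.natCast_eq_zero_iff] at h
  obtain ⟨m, hm⟩ := h
  exact ⟨m, by rw [← ZMod.natCast_zmod_val a, hm, Nat.cast_mul, Nat.cast_ofNat]⟩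

/-- Two matrices over `ℤ/9ℤ` with the same reduction modulo `3` differ by `3` times a matrix.
[folklore] -/
theorem exists_eq_add_three_smul_of_map_eq (X Y : Matrix (Fin 2) (Fin 2) (ZMod 9))
    (h : X.map (ZMod.castHom three_dvd_nine (ZMod 3)) =
      Y.map (ZMod.castHom three_dvd_nine (ZMod 3))) :
    ∃ C : Matrix (Fin 2) (Fin 2) (ZMod 9), X = Y + (3 : ZMod 9) • C := by
  have hij : ∀ i k, ∃ c : ZMod 9, X i k - Y i k = 3 * c := fun i k ↦ by
    apply exists_eq_three_mul_of_castHom_eq_zero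
    have := congrFun (congrFun h i) k
    simp only [Matrix.map_apply] at this
    rw [map_sub, this, sub_self]
  choose c hc using hij
  refine ⟨Matrix.of fun i k ↦ c i k, Matrix.ext fun i k ↦ ?_⟩
  rw [Matrix.add_apply, Matrix.smul_apply, Matrix.of_apply, smul_eq_mul, ← hc]
  abel

/-- If two matrices over `ℤ/9ℤ` agree modulo `3`, their triples agree. [folklore] -/
theorem three_smul_eq_of_map_eq (X Y : Matrix (Fin 2) (Fin 2) (ZMod 9))
    (h : X.map (ZMod.castHom three_dvd_nine (ZMod 3)) =
      Y.map (ZMod.castHom three_dvd_nine (ZMod 3))) :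
    (3 : ZMod 9) • X = (3 : ZMod 9) • Y := by
  obtain ⟨C, hC⟩ := exists_eq_add_three_smul_of_map_eq X Y h
  rw [hC, smul_add, smul_smul, three_mul_three_zmod, zero_smul, add_zero]

/-- `3X · 3Y = 0` for matrices over `ℤ/9ℤ`. [folklore] -/
theorem three_smul_mul_three_smul (C D : Matrix (Fin 2) (Fin 2) (ZMod 9)) :
    ((3 : ZMod 9) • C) * ((3 : ZMod 9) • D) = 0 := by
  rw [Matrix.smul_mul, Matrix.mul_smul, smul_smul, three_mul_three_zmod, zero_smul]

/-- The reduction of `GL₂(ℤ/9ℤ) → GL₂(ℤ/3ℤ)` on matrices is entrywise reduction. [folklore] -/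
theorem coe_map_castHom (g : GL (Fin 2) (ZMod 9)) :
    ((Matrix.GeneralLinearGroup.map (ZMod.castHom three_dvd_nine (ZMod 3)) g :
      GL (Fin 2) (ZMod 3)) : Matrix (Fin 2) (Fin 2) (ZMod 3)) =
      (g : Matrix (Fin 2) (Fin 2) (ZMod 9)).map (ZMod.castHom three_dvd_nine (ZMod 3)) :=
  rfl

/-- An element of `GL₂(ℤ/9ℤ)` reducing to `1` is `1 + 3C`. [folklore] -/
theorem exists_coe_eq_one_add_three_smul (g : GL (Fin 2) (ZMod 9))
    (hg : Matrix.GeneralLinearGroup.map (ZMod.castHom three_dvd_nine (ZMod 3)) g = 1) :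
    ∃ C : Matrix (Fin 2) (Fin 2) (ZMod 9),
      (g : Matrix (Fin 2) (Fin 2) (ZMod 9)) = 1 + (3 : ZMod 9) • C := by
  apply exists_eq_add_three_smul_of_map_eq
  rw [← coe_map_castHom, hg, Matrix.map_one _ (map_zero _) (map_one _)]
  rfl

/-- `det (1 + 3C) = 1 + tr (3C)` over `ℤ/9ℤ` (`2 × 2`). [folklore] -/
theorem det_one_add_three_smul (C : Matrix (Fin 2) (Fin 2) (ZMod 9)) :
    (1 + (3 : ZMod 9) • C).det = 1 + (3 * C 0 0 + 3 * C 1 1) := by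
  rw [Matrix.det_fin_two]
  simp only [Matrix.add_apply, Matrix.one_apply_eq, Matrix.smul_apply, smul_eq_mul,
    Matrix.one_apply_ne (show (0 : Fin 2) ≠ 1 by decide),
    Matrix.one_apply_ne (show (1 : Fin 2) ≠ 0 by decide), zero_add]
  linear_combination (C 0 0 * C 1 1 - C 0 1 * C 1 0) * nine_eq_zero_zmod

end LevelNineArithmetic

/-! ### The kernel lattice of a subgroup `H ≤ GL₂(ℤ/9ℤ)` mapping onto `GL₂(𝔽₃)` -/

section KernelLattice

variable {H : Subgroup (GL (Fin 2) (ZMod 9))}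

/-- `1 = 1 + 3·0` lies in every subgroup. [folklore] -/
theorem kernel_zero_mem :
    ∃ h ∈ H, (h : Matrix (Fin 2) (Fin 2) (ZMod 9)) =
      1 + (3 : ZMod 9) • (0 : Matrix (Fin 2) (Fin 2) (ZMod 9)) :=
  ⟨1, H.one_mem, by rw [smul_zero, add_zero, Units.val_one]⟩

/-- If `1 + 3C₁, 1 + 3C₂ ∈ H` then `1 + 3(C₁ + C₂) ∈ H` (the product). [folklore] -/
theorem kernel_add_mem {C₁ C₂ : Matrix (Fin 2) (Fin 2) (ZMod 9)}
    (h₁ : ∃ h ∈ H, (h : Matrix (Fin 2) (Fin 2) (ZMod 9)) = 1 + (3 : ZMod 9) • C₁)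
    (h₂ : ∃ h ∈ H, (h : Matrix (Fin 2) (Fin 2) (ZMod 9)) = 1 + (3 : ZMod 9) • C₂) :
    ∃ h ∈ H, (h : Matrix (Fin 2) (Fin 2) (ZMod 9)) = 1 + (3 : ZMod 9) • (C₁ + C₂) := by
  obtain ⟨g₁, hg₁, e₁⟩ := h₁
  obtain ⟨g₂, hg₂, e₂⟩ := h₂
  refine ⟨g₁ * g₂, H.mul_mem hg₁ hg₂, ?_⟩
  have hexp : ∀ X Y : Matrix (Fin 2) (Fin 2) (ZMod 9),
      (1 + X) * (1 + Y) = 1 + (X + Y) + X * Y := fun X Y ↦ by noncomm_ring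
  rw [Units.val_mul, e₁, e₂, hexp, three_smul_mul_three_smul, add_zero, smul_add]

/-- If `1 + 3C ∈ H` then `1 + 3(-C) = (1 + 3C)⁻¹ ∈ H`. [folklore] -/
theorem kernel_neg_mem {C : Matrix (Fin 2) (Fin 2) (ZMod 9)}
    (hC : ∃ h ∈ H, (h : Matrix (Fin 2) (Fin 2) (ZMod 9)) = 1 + (3 : ZMod 9) • C) :
    ∃ h ∈ H, (h : Matrix (Fin 2) (Fin 2) (ZMod 9)) = 1 + (3 : ZMod 9) • (-C) := by
  obtain ⟨g, hg, e⟩ := hC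
  refine ⟨g⁻¹, H.inv_mem hg, ?_⟩
  have hexp : ∀ X : Matrix (Fin 2) (Fin 2) (ZMod 9), (1 + X) * (1 - X) = 1 - X * X :=
    fun X ↦ by noncomm_ring
  have hmul : (g : Matrix (Fin 2) (Fin 2) (ZMod 9)) * (1 - (3 : ZMod 9) • C) = 1 := by
    rw [e, hexp, three_smul_mul_three_smul, sub_zero]
  calc ((g⁻¹ : GL (Fin 2) (ZMod 9)) : Matrix (Fin 2) (Fin 2) (ZMod 9))
      = ((g⁻¹ : GL (Fin 2) (ZMod 9)) : Matrix (Fin 2) (Fin 2) (ZMod 9)) *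
          ((g : Matrix (Fin 2) (Fin 2) (ZMod 9)) * (1 - (3 : ZMod 9) • C)) := by
        rw [hmul, mul_one]
    _ = 1 - (3 : ZMod 9) • C := by rw [← mul_assoc, Units.inv_mul, one_mul]
    _ = 1 + (3 : ZMod 9) • (-C) := by rw [smul_neg, sub_eq_add_neg]

/-- Differences. [folklore] -/
theorem kernel_sub_mem {C₁ C₂ : Matrix (Fin 2) (Fin 2) (ZMod 9)}
    (h₁ : ∃ h ∈ H, (h : Matrix (Fin 2) (Fin 2) (ZMod 9)) = 1 + (3 : ZMod 9) • C₁)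
    (h₂ : ∃ h ∈ H, (h : Matrix (Fin 2) (Fin 2) (ZMod 9)) = 1 + (3 : ZMod 9) • C₂) :
    ∃ h ∈ H, (h : Matrix (Fin 2) (Fin 2) (ZMod 9)) = 1 + (3 : ZMod 9) • (C₁ - C₂) := by
  rw [sub_eq_add_neg]
  exact kernel_add_mem h₁ (kernel_neg_mem h₂)

/-- Natural multiples. [folklore] -/
theorem kernel_nsmul_mem {C : Matrix (Fin 2) (Fin 2) (ZMod 9)}
    (hC : ∃ h ∈ H, (h : Matrix (Fin 2) (Fin 2) (ZMod 9)) = 1 + (3 : ZMod 9) • C) (n : ℕ) :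
    ∃ h ∈ H, (h : Matrix (Fin 2) (Fin 2) (ZMod 9)) = 1 + (3 : ZMod 9) • (n • C) := by
  induction n with
  | zero => rw [zero_smul]; exact kernel_zero_mem
  | succ n ih => rw [succ_nsmul]; exact kernel_add_mem ih hC

/-- Only `3C` matters. [folklore] -/
theorem kernel_congr {C C' : Matrix (Fin 2) (Fin 2) (ZMod 9)}
    (hC : ∃ h ∈ H, (h : Matrix (Fin 2) (Fin 2) (ZMod 9)) = 1 + (3 : ZMod 9) • C)
    (e : (3 : ZMod 9) • C = (3 : ZMod 9) • C') :
    ∃ h ∈ H, (h : Matrix (Fin 2) (Fin 2) (ZMod 9)) = 1 + (3 : ZMod 9) • C' := by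
  obtain ⟨g, hg, hgC⟩ := hC
  exact ⟨g, hg, by rw [hgC, e]⟩

/-- **Conjugation-stability of the kernel lattice**: if `H` maps onto `GL₂(𝔽₃)` and
`1 + 3C ∈ H`, then `1 + 3·UCU⁻¹ ∈ H` for EVERY `U ∈ GL₂(ℤ/9ℤ)` (conjugate by a lift of `Ū`
in `H`; modulo `9`, `3·hCh⁻¹` only depends on `h mod 3`). [folklore] -/
theorem kernel_conj_mem
    (hπ : ∀ t : GL (Fin 2) (ZMod 3), ∃ h ∈ H,
      Matrix.GeneralLinearGroup.map (ZMod.castHom three_dvd_nine (ZMod 3)) h = t)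
    {C : Matrix (Fin 2) (Fin 2) (ZMod 9)}
    (hC : ∃ h ∈ H, (h : Matrix (Fin 2) (Fin 2) (ZMod 9)) = 1 + (3 : ZMod 9) • C)
    (U : GL (Fin 2) (ZMod 9)) :
    ∃ h ∈ H, (h : Matrix (Fin 2) (Fin 2) (ZMod 9)) =
      1 + (3 : ZMod 9) • ((U : Matrix (Fin 2) (Fin 2) (ZMod 9)) * C *
        ((U⁻¹ : GL (Fin 2) (ZMod 9)) : Matrix (Fin 2) (Fin 2) (ZMod 9))) := by
  obtain ⟨g, hg, e⟩ := hC
  obtain ⟨h₁, hh₁, hπ₁⟩ := hπ (Matrix.GeneralLinearGroup.map (ZMod.castHom three_dvd_nine (ZMod 3)) U)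
  refine ⟨h₁ * g * h₁⁻¹, H.mul_mem (H.mul_mem hh₁ hg) (H.inv_mem hh₁), ?_⟩
  have hX : (3 : ZMod 9) • ((h₁ : Matrix (Fin 2) (Fin 2) (ZMod 9)) * C *
        ((h₁⁻¹ : GL (Fin 2) (ZMod 9)) : Matrix (Fin 2) (Fin 2) (ZMod 9))) =
      (3 : ZMod 9) • ((U : Matrix (Fin 2) (Fin 2) (ZMod 9)) * C *
        ((U⁻¹ : GL (Fin 2) (ZMod 9)) : Matrix (Fin 2) (Fin 2) (ZMod 9))) := by
    apply three_smul_eq_of_map_eq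
    simp only [Matrix.map_mul, ← coe_map_castHom, map_inv, hπ₁]
  calc ((h₁ * g * h₁⁻¹ : GL (Fin 2) (ZMod 9)) : Matrix (Fin 2) (Fin 2) (ZMod 9))
      = (h₁ : Matrix (Fin 2) (Fin 2) (ZMod 9)) * (1 + (3 : ZMod 9) • C) *
          ((h₁⁻¹ : GL (Fin 2) (ZMod 9)) : Matrix (Fin 2) (Fin 2) (ZMod 9)) := by
        rw [Units.val_mul, Units.val_mul, e]
    _ = (h₁ : Matrix (Fin 2) (Fin 2) (ZMod 9)) *
          ((h₁⁻¹ : GL (Fin 2) (ZMod 9)) : Matrix (Fin 2) (Fin 2) (ZMod 9)) +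
        (3 : ZMod 9) • ((h₁ : Matrix (Fin 2) (Fin 2) (ZMod 9)) * C *
          ((h₁⁻¹ : GL (Fin 2) (ZMod 9)) : Matrix (Fin 2) (Fin 2) (ZMod 9))) := by
        rw [Matrix.mul_add, Matrix.mul_one, Matrix.add_mul, Matrix.mul_smul, Matrix.smul_mul]
    _ = 1 + (3 : ZMod 9) • ((U : Matrix (Fin 2) (Fin 2) (ZMod 9)) * C *
        ((U⁻¹ : GL (Fin 2) (ZMod 9)) : Matrix (Fin 2) (Fin 2) (ZMod 9))) := by
        rw [Units.mul_inv, hX]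

/-- Concrete elements of `GL₂(ℤ/9ℤ)` from a matrix and a two-sided inverse. [folklore] -/
theorem exists_generalLinearGroup_coe_eq (A B : Matrix (Fin 2) (Fin 2) (ZMod 9))
    (hAB : A * B = 1) (hBA : B * A = 1) :
    ∃ U : GL (Fin 2) (ZMod 9), (U : Matrix (Fin 2) (Fin 2) (ZMod 9)) = A ∧
      ((U⁻¹ : GL (Fin 2) (ZMod 9)) : Matrix (Fin 2) (Fin 2) (ZMod 9)) = B :=
  ⟨⟨A, B, hAB, hBA⟩, rfl, rfl⟩

/-- The upper unipotent `u = (1 1; 0 1)` of `GL₂(ℤ/9ℤ)` and its inverse. [folklore] -/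
theorem exists_upper_unipotent_nine :
    ∃ U : GL (Fin 2) (ZMod 9), (U : Matrix (Fin 2) (Fin 2) (ZMod 9)) = !![1, 1; 0, 1] ∧
      ((U⁻¹ : GL (Fin 2) (ZMod 9)) : Matrix (Fin 2) (Fin 2) (ZMod 9)) = !![1, 8; 0, 1] :=
  exists_generalLinearGroup_coe_eq _ _ (by decide) (by decide)

/-- The lower unipotent `l = (1 0; 1 1)` of `GL₂(ℤ/9ℤ)` and its inverse. [folklore] -/
theorem exists_lower_unipotent_nine :
    ∃ U : GL (Fin 2) (ZMod 9), (U : Matrix (Fin 2) (Fin 2) (ZMod 9)) = !![1, 0; 1, 1] ∧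
      ((U⁻¹ : GL (Fin 2) (ZMod 9)) : Matrix (Fin 2) (Fin 2) (ZMod 9)) = !![1, 0; 8, 1] :=
  exists_generalLinearGroup_coe_eq _ _ (by decide) (by decide)

/-- The involution `D = diag(-1, 1) = (8 0; 0 1)` of `GL₂(ℤ/9ℤ)`. [folklore] -/
theorem exists_diag_neg_one_nine :
    ∃ U : GL (Fin 2) (ZMod 9), (U : Matrix (Fin 2) (Fin 2) (ZMod 9)) = !![8, 0; 0, 1] ∧
      ((U⁻¹ : GL (Fin 2) (ZMod 9)) : Matrix (Fin 2) (Fin 2) (ZMod 9)) = !![8, 0; 0, 1] :=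
  exists_generalLinearGroup_coe_eq _ _ (by decide) (by decide)

/-- The involution `w = (0 1; 1 0)` of `GL₂(ℤ/9ℤ)`. [folklore] -/
theorem exists_swap_nine :
    ∃ U : GL (Fin 2) (ZMod 9), (U : Matrix (Fin 2) (Fin 2) (ZMod 9)) = !![0, 1; 1, 0] ∧
      ((U⁻¹ : GL (Fin 2) (ZMod 9)) : Matrix (Fin 2) (Fin 2) (ZMod 9)) = !![0, 1; 1, 0] :=
  exists_generalLinearGroup_coe_eq _ _ (by decide) (by decide)

/-- `u C u⁻¹ - C` for `u = (1 1; 0 1)` over `ℤ/9ℤ`. [folklore] -/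
theorem upper_conj_sub (a b c d : ZMod 9) :
    !![(1 : ZMod 9), 1; 0, 1] * !![a, b; c, d] * !![1, 8; 0, 1] - !![a, b; c, d] =
      !![c, 8 * a + 8 * c + d; 0, 8 * c] := by
  ext i j; fin_cases i <;> fin_cases j <;> simp <;> ring

/-- `D C D⁻¹ - C` for `D = diag(-1, 1)` over `ℤ/9ℤ`. [folklore] -/
theorem diag_conj_sub (a b c d : ZMod 9) :
    !![(8 : ZMod 9), 0; 0, 1] * !![a, b; c, d] * !![8, 0; 0, 1] - !![a, b; c, d] =
      !![63 * a, 7 * b; 7 * c, 0] := by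
  ext i j; fin_cases i <;> fin_cases j <;> simp <;> ring

end KernelLattice

end Summit.BirchSwinnertonDyer.BirchSwinnertonDyer.Theorems.LevelNine
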